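import Summits.BirchSwinnertonDyer.BirchSwinnertonDyer.Theorems.KimAtThreeShallowEqDeepPortNonAddUnramified
import Summits.BirchSwinnertonDyer.BirchSwinnertonDyer.Theorems.KimAtThreeShallowEqDeepCertSupplyNonAdd
import Summits.BirchSwinnertonDyer.Rank1Residual.GaloisImage.LocalThreeTorsionAdicCompletion
import Literature.NumberTheory.EllipticCurves.TorsionFrobeniusProofs
import HarnessLib

/-!
# Route `KimAtThreeKolyvagin` (W2): the off-stratum port on the NON-ADDITIVE rows FROM THE FINE KATO PACKAGE
# (C1′ = C1 with the (P-EXP) riders at exponent `1`) AND NON-ANOMALY ALONE — certificates supplied, no `hbad`,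
# no `9 ∣ N`; and the SHALLOW = DEEP / LEAF row conclusions of cruxes 19599 / 19077 there from PUB + (C1′)

Cell `bsd-addord`, seat `bsd-addord-w2-c4` (gen 8; owner of crux 19599 `ShallowEqDeepOffKatoStratum`, item
19077 `ShallowEqDeepAtTorsionFree`).  `--supports` 19599.  HONEST FRAMING: theorems only (no definition, no
named fact, no instance, no `sorry`); (C1′) — Kato's `ZetaBody` family for `P.f` at the conductor level with
R-κ and n1011's (P-EXP) riders AT EXPONENT `1` — enters as the displayed HYPOTHESIS `hC1` (never obtained: it
is the conclusion of the PUBLISHED fact `Kato2004.exists_eulerSystem_expStar_values` strengthened by exactly the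
rider + R-κ, i.e. the debt class K22-Thm3.13-PORT@3 / (C1) of crux 19560 read with the rider at exponent `1`);
nothing asserted, nothing booked; 19560 / 19599 / 19077 stay OPEN; BSD is not proved by any of this.

## What (the off-stratum residual of W2 on the non-additive non-anomalous rows, in ONE displayed hypothesis)

Gens 5–7 of this seat typed the obstruction of 19599's `stub_nonAdditive` as ONE untyped object PORT_nonadd@3
(definition item `defn-KatoKuriharaDictionaryThreeNonAddAt`, 4 typer attempts, open).  This gen's files
(`…ZetaBodyScaling`, `…ValueRowsNonAdd`, `…PortNonAdd`, `…PortNonAddUnramified`, `…CertSupplyNonAdd`) show it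
is not a new dictionary: on a `t = 0` row whose reduction at `3` is good NON-anomalous, supersingular or
multiplicative with `3 ∤ c₃` (lattice `exp*_ω(H¹(ℚ₃,T)) = 3⁻¹ℤ₃`) the unlocked port is ★ PK-6₂ on the
`3`-SCALED zeta body.  THIS FILE assembles the END: §1 `portUnlocked_zero_of_fineKato₁_of_nonanomalous` — the
UNLOCKED Kato–Kurihara port (PORT@3-OFF / PORT@3-ALL's inner text at one `(W, v₃, η, P)`) from surj(3),
`#E(ℚ₃)[3] = 1`, the non-anomaly certificate `3 ∤ 3 + 𝟙_{3∤N} − a₃` and (C1′) ALONE — the auxiliary cusp datum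
and its certificates SUPPLIED by `KimAtThreeShallowEqDeepCertSupplyNonAdd.certSupply_row_nonAdd`, THEOREM D's
`hbad` REMOVED by `KimAtThreeShallowEqDeepPortNonAddUnramified` (w2-c3's D-u chain), `ht0` from `#E(ℚ₃)[3] = 1`
by transport `ℚ_[3] ≃ ℚ_w` (as in kim3's p448445), the Tate-module instance binders
discharged inside; §2 the same in PortRows' two-exponent currency; §3 **`shallowEqDeep_row_of_fineKato₁_of_nonanomalous`**
— 19599 / 19077's conclusion `∂^{(∞)}_deep(δ̃) ≤ ∂^{(∞)}(δ̃)` AT such a tower row with the datum at the conductor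
from [S24] Thm 4.4 (1)(2) + GZK + Poitou–Tate (PUB, by name) + `3`-integral plus symbols + `ord(δ̃) = 0` + a place
`v₃ ∣ 3` + one generator family `η` + (C1′) + non-anomaly; §3 `leaf_row_…` — Kim's clause (6) at the row likewise.
READING (08-28): the W2 off-stratum residual on the non-additive non-anomalous rows IS the debt class (C1) of
19560 with the rider read at exponent `1`; no second port item and no new definition are needed there.  Left
outside, typed elsewhere: good ANOMALOUS `3` (`3 ∣ 4 − a₃`), multiplicative `3 ∣ c₃` and IV/IV* (acc6 / acc1's
two-exponent port), `3 ∣ c_{D₀}` (Manin), `t ≥ 1`.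
HONEST LIMITS: `t = 0` only; (C1′) displayed; nothing booked.

References: [Kato2004Asterisque] (8.1.3), §6.2, Thm. 6.6 (1), §9.4, Thm. 9.7, Ex. 13.3; [Kim2022StructureSelmer]
Lemma 3.3, Thm. 3.13, Thm. 1.9 (6); [Kim2025RefinedTNC] Thm 1.1/1.2; [MazurRubin2004] Thm. 3.2.4, 4.4.1, 5.2.12,
App. A; [Sakamoto2024] Thm. 4.4; [Manin1972] Prop. 1.4, Thm. 1.6; memo HOME/w2c4/W2C4-PORTSEAM-g7.md §5.
-/

set_option autoImplicit false
-- the Theorems namespace of a single-conjunct summit repeats the summit name by design (D-0017)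
set_option linter.dupNamespace false

noncomputable section

open scoped NumberField TensorProduct ContRepresentation Classical
open CategoryTheory Field Function Finset IsDedekindDomain NumberField WeierstrassCurve
open Rat.HeightOneSpectrum
open Literature.NumberTheory.GaloisRepresentations Literature.NumberTheory.GaloisCohomology
open Literature.NumberTheory.GaloisRepresentations.DiscreteGaloisModule
open Literature.NumberTheory.EllipticCurves Literature.NumberTheory.EllipticCurves.ModularForms
open Literature.NumberTheory.EllipticCurves.Kato2004
open Literature.NumberTheory.EllipticCurves.Kato2004.EulerSystemValues

namespace Summit.BirchSwinnertonDyer.BirchSwinnertonDyer.Theorems.KimAtThreeShallowEqDeepPortNonAddFineKato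

open Summit.BirchSwinnertonDyer.Rank1Residual.GaloisImage
open Summit.BirchSwinnertonDyer.BirchSwinnertonDyer.Theorems
open Summit.BirchSwinnertonDyer.BirchSwinnertonDyer.Theorems.KimAtThreeShallowEqDeepPortNonAddUnramified
open Summit.BirchSwinnertonDyer.BirchSwinnertonDyer.Theorems.KimAtThreeShallowEqDeepCertSupplyNonAdd

/-! ### §1 The unlocked port at a non-additive non-anomalous `t = 0` row from (C1′) alone -/

section Row

variable (W : WeierstrassCurve ℚ) [W.IsElliptic] [W.IsGloballyMinimal]
  [ContinuousSMul ℤ_[3] (W.tateModule 3)] [Module.Free ℤ_[3] (W.tateModule 3)]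
  [Module.Finite ℤ_[3] (W.tateModule 3)]

set_option backward.isDefEq.respectTransparency false in
/-- **The UNLOCKED Kato–Kurihara port at a NON-ADDITIVE non-anomalous `t = 0` row FROM (C1′) ALONE.**
Displayed: the parametrisation datum `P` at the conductor level (`hN`), surj(3), the place `v₃ ∣ 3`,
`#E(ℚ₃)[3] = 1` (the cruxes' `t = 0` binder verbatim), the non-anomaly certificate `3 ∤ 3 + 𝟙_{3∤N} − a₃(f)`
(`#Ẽ(𝔽₃)` at a good `3`, `3 ∓ 1` at a multiplicative `3`; false at an additive `3`), and (C1′) at the row —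
Kato's `ZetaBody` family for `P.f` with R-κ and the exponent-`1` riders.  Inside: the auxiliary cusp datum with
its certificates from `certSupply_row_nonAdd`, `ht0` by transport `ℚ_[3] ≃ ℚ_w` (`LocalTorsion3`), the witnesses from (C1′), the port by
`katoKuriharaPortUnlocked_zero_of_zetaBody_nonAdd_of_unramified` (no `hbad`, no `9 ∣ N`).  Concluded: the
unlocked port at `(W, v₃, η, P)` for EVERY generator family `η`.  Nothing asserted; nothing booked.
[cite: Kato2004Asterisque, (8.1.3) (p. 180), §9.4 (p. 188), Thm. 9.7 (p. 189), Thm. 6.6 (1) (p. 163) and Ex. 13.3 (pp. 224–225)]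
[cite: Kim2022StructureSelmer, Lemma 3.3 and Thm. 3.13 (arXiv v3 pp. 17–18, 26–28)]
[cite: MazurRubin2004, Thm. 3.2.4 and App. A (Lemma A.1, Remark A.5)] [cite: Manin1972, Prop. 1.4  Thm. 1.6] -/
theorem portUnlocked_zero_of_fineKato₁_of_nonanomalous
    {N : ℕ} [NeZero N] (P : ModularParametrizationData W N) (hN : N = W.conductorNorm ℤ)
    (hsurj : W.HasSurjectiveModNGaloisRep ((3 : ℕ) : ℤ))
    {v₃ : HeightOneSpectrum (𝓞 ℚ)} (hv₃ : ((3 : ℕ) : 𝓞 ℚ) ∈ v₃.asIdeal)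
    (ht : Nat.card {Q : (W.baseChange ℚ_[3]).toAffine.Point // (3 : ℕ) • Q = 0} = 1)
    {t₃ : ℤ} (ht₃ : cuspCoeff P.f 3 = t₃) (h3a : ¬ (3 : ℤ) ∣ 3 + (if 3 ∣ N then 0 else 1) - t₃)
    -- (C1′) the fine Kato package AT THE ROW with the (P-EXP) riders AT EXPONENT `1`
    (hC1 : ∃ (ι : (n : ℕ) → (CyclotomicField n ℚ →+* ℂ)) (κK : ℝ)
        (Λ : ∀ (k' : ℕ) (r : Finset (HeightOneSpectrum (𝓞 ℚ))),
          H1 (tateRep W 3) (cycSubgroup 3 k' r) →ₗ[ℤ_[3]]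
            ℚ_[3] ⊗[ℚ] CyclotomicField (cycLevel 3 k' r) ℚ)
        (Λfin : ∀ j : ℕ, galoisCohomology
          ((W.torsionGaloisModule (((3 : ℕ) : ℤ) ^ j * ((3 : ℕ) : ℤ))).toLocal (Sum.inr v₃)) 1 →+
            ZMod (3 ^ (j + 1))),
        κK ≠ 0 ∧ (∃ u : ℚ, (u : ℝ) = κK ∧ padicValRat 3 u = 0) ∧
        (∀ j : ℕ, KatoExpStarFiniteLevelAt W 3 j 1 v₃ Λ (Λfin j)) ∧
        ∀ (c d a : ℤ) (A : ℕ), 0 < A → Int.gcd c (6 * 3 * A) = 1 → Int.gcd d (6 * 3 * N) = 1 →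
          ∃ (z : ∀ (k' : ℕ) (r : (cyclotomicLevelsRat 3 (badPlaces c d A N)).Ideals),
                H1 (tateRep W 3) ((cyclotomicLevelsRat 3 (badPlaces c d A N)).level k' r.1))
            (x : ∀ (k' : ℕ) (r : (cyclotomicLevelsRat 3 (badPlaces c d A N)).Ideals),
                CyclotomicField (cycLevel 3 k' r.1) ℚ),
            ZetaBody W 3 P.f ι κK Λ c d a A z x)
    (η : (q : HeightOneSpectrum (𝓞 ℚ)) → (ZMod (Ideal.absNorm q.asIdeal))ˣ) :
    ∀ (k k' : ℕ) (D : KolyvaginDatum (W.torsionGaloisModule (((3 : ℕ) : ℤ) ^ k * ((3 : ℕ) : ℤ))))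
      (D' : KolyvaginDatum (W.torsionGaloisModule (((3 : ℕ) : ℤ) ^ k' * ((3 : ℕ) : ℤ))))
      (red : (W.torsionGaloisModule (((3 : ℕ) : ℤ) ^ k' * ((3 : ℕ) : ℤ))).toContRepresentation →ⁱL
        (W.torsionGaloisModule (((3 : ℕ) : ℤ) ^ k * ((3 : ℕ) : ℤ))).toContRepresentation),
      D.IsCanonicalTauDatumThreeAtWith W k k η → D'.IsCanonicalTauDatumThreeAtWith W k' k' η → k ≤ k' →
      (∀ y : geomTorsion W (((3 : ℕ) : ℤ) ^ k' * ((3 : ℕ) : ℤ)),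
        ((red y : geomTorsion W (((3 : ℕ) : ℤ) ^ k * ((3 : ℕ) : ℤ))) : geomPoints W) =
          (((3 : ℕ) : ℤ) ^ (k' - k)) • (y : geomPoints W)) →
      ∃ κ Λ₀ κ' κu Λu κu',
        KatoKuriharaWitnessAt W k 0 D v₃ P κ Λ₀ κ' ∧ KatoKuriharaWitnessAt W k' 0 D' v₃ P κu Λu κu' ∧
        ∀ e, D'.IsLevel e → D.IsLevel e →
          galoisCohomology.map red 1 (κu e) = κ e ∧ galoisCohomology.map red 1 (κu' e) = κ' e := by
  obtain ⟨ι, κK, Λ, Λfin, hκ0, hNorm, hfin, hz⟩ := hC1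
  obtain ⟨c, d, a, A, d', aM, hA, hcA, hdN, hcdA, hcd, hdd', hAN, haM, hE0, hE, hR0, hR⟩ :=
    certSupply_row_nonAdd W (by simpa using hsurj) P ht₃ h3a
  haveI : NeZero A := ⟨hA.ne'⟩
  obtain ⟨z, x, hbody⟩ := hz c d a A hA hcA hdN
  -- THEOREM D-u's certificate `ht0` from `#E(ℚ₃)[3] = 1` (transport `ℚ_[3] ≃ ℚ_w`, as in kim3's p448445)
  have ht0 : ∀ w : HeightOneSpectrum (𝓞 ℚ), ((3 : ℕ) : 𝓞 ℚ) ∈ w.asIdeal →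
      ∀ Q : (W.baseChange (w.adicCompletion ℚ)).toAffine.Point, 3 • Q = 0 → Q = 0 := by
    intro w hw Q hQ
    have hw3 : ((primesEquiv w : Nat.Primes) : ℕ) = 3 := primesEquiv_eq_of_natCast_mem Nat.prime_three hw
    have hker := LocalTorsion3.natCard_ker_nsmul_adicCompletion_eq_natCard_torsion_padic W w hw3 3
    rw [ht] at hker
    have hbot := (AddSubgroup.card_eq_one).mp hker
    have hmem : Q ∈ (nsmulAddMonoidHom 3 : (W.baseChange (w.adicCompletion ℚ)).toAffine.Point →+
        (W.baseChange (w.adicCompletion ℚ)).toAffine.Point).ker := by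
      rw [AddMonoidHom.mem_ker, nsmulAddMonoidHom_apply]
      exact hQ
    rw [hbot] at hmem
    exact (AddSubgroup.mem_bot).mp hmem
  exact katoKuriharaPortUnlocked_zero_of_zetaBody_nonAdd_of_unramified W P hN hbody hNorm hκ0 d' hcd hdd'
    hAN aM haM hE0 hE hR0 hR hv₃ hsurj Λfin hfin hcdA ht0

end Row

/-! ### §2–§3 The row conclusions of W2 there (instance binders discharged inside) -/

section Rows

variable (W : WeierstrassCurve ℚ) [W.IsElliptic] [W.IsGloballyMinimal]

set_option backward.isDefEq.respectTransparency false in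
/-- **The port of §1 in `KimAtThreeShallowEqDeepPortRows`' two-exponent currency** (`(t, e) = (0, 0)`), the
Tate-module instance binders DISCHARGED (`TateModule.continuousSMul_padicInt`,
`W.module_free_tateModule_holds 3`, `W.module_finite_tateModule_holds 3`) — so (C1′) is stated under
`∀ [ContinuousSMul …] [Module.Free …] [Module.Finite …]`.  Displayed as in §1.
[cite: Kim2022StructureSelmer, Thm. 3.13 (arXiv v3 p. 17)] [cite: Kato2004Asterisque, Thm. 9.7 (p. 189)] -/
theorem portTwoExp_zero_of_fineKato₁_of_nonanomalous
    {N : ℕ} [NeZero N] (D : ModularParametrizationData W N) (hN : N = W.conductorNorm ℤ)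
    (hsurj : W.HasSurjectiveModNGaloisRep ((3 : ℕ) : ℤ))
    {v₃ : HeightOneSpectrum (𝓞 ℚ)} (hv₃ : ((3 : ℕ) : 𝓞 ℚ) ∈ v₃.asIdeal)
    (ht : Nat.card {Q : (W.baseChange ℚ_[3]).toAffine.Point // (3 : ℕ) • Q = 0} = 1)
    {t₃ : ℤ} (ht₃ : cuspCoeff D.f 3 = t₃) (h3a : ¬ (3 : ℤ) ∣ 3 + (if 3 ∣ N then 0 else 1) - t₃)
    (hC1 : ∀ [ContinuousSMul ℤ_[3] (W.tateModule 3)] [Module.Free ℤ_[3] (W.tateModule 3)]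
      [Module.Finite ℤ_[3] (W.tateModule 3)],
      ∃ (ι : (n : ℕ) → (CyclotomicField n ℚ →+* ℂ)) (κK : ℝ)
        (Λ : ∀ (k' : ℕ) (r : Finset (HeightOneSpectrum (𝓞 ℚ))),
          H1 (tateRep W 3) (cycSubgroup 3 k' r) →ₗ[ℤ_[3]]
            ℚ_[3] ⊗[ℚ] CyclotomicField (cycLevel 3 k' r) ℚ)
        (Λfin : ∀ j : ℕ, galoisCohomology
          ((W.torsionGaloisModule (((3 : ℕ) : ℤ) ^ j * ((3 : ℕ) : ℤ))).toLocal (Sum.inr v₃)) 1 →+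
            ZMod (3 ^ (j + 1))),
        κK ≠ 0 ∧ (∃ u : ℚ, (u : ℝ) = κK ∧ padicValRat 3 u = 0) ∧
        (∀ j : ℕ, KatoExpStarFiniteLevelAt W 3 j 1 v₃ Λ (Λfin j)) ∧
        ∀ (c d a : ℤ) (A : ℕ), 0 < A → Int.gcd c (6 * 3 * A) = 1 → Int.gcd d (6 * 3 * N) = 1 →
          ∃ (z : ∀ (k' : ℕ) (r : (cyclotomicLevelsRat 3 (badPlaces c d A N)).Ideals),
                H1 (tateRep W 3) ((cyclotomicLevelsRat 3 (badPlaces c d A N)).level k' r.1))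
            (x : ∀ (k' : ℕ) (r : (cyclotomicLevelsRat 3 (badPlaces c d A N)).Ideals),
                CyclotomicField (cycLevel 3 k' r.1) ℚ),
            ZetaBody W 3 D.f ι κK Λ c d a A z x)
    (η : (q : HeightOneSpectrum (𝓞 ℚ)) → (ZMod (Ideal.absNorm q.asIdeal))ˣ) :
    ∀ (k k' : ℕ) (Dk : KolyvaginDatum (W.torsionGaloisModule (((3 : ℕ) : ℤ) ^ k * ((3 : ℕ) : ℤ))))
      (Dk' : KolyvaginDatum (W.torsionGaloisModule (((3 : ℕ) : ℤ) ^ k' * ((3 : ℕ) : ℤ))))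
      (red : (W.torsionGaloisModule (((3 : ℕ) : ℤ) ^ k' * ((3 : ℕ) : ℤ))).toContRepresentation →ⁱL
        (W.torsionGaloisModule (((3 : ℕ) : ℤ) ^ k * ((3 : ℕ) : ℤ))).toContRepresentation),
      Dk.IsCanonicalTauDatumThreeAtWith W k k η → Dk'.IsCanonicalTauDatumThreeAtWith W k' k' η → k ≤ k' →
      (∀ y : geomTorsion W (((3 : ℕ) : ℤ) ^ k' * ((3 : ℕ) : ℤ)),
        ((red y : geomTorsion W (((3 : ℕ) : ℤ) ^ k * ((3 : ℕ) : ℤ))) : geomPoints W) =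
          (((3 : ℕ) : ℤ) ^ (k' - k)) • (y : geomPoints W)) →
      ∃ κ Λ₀ κ' κu Λu κu',
        KimAtThreeKolyvaginDefs.KatoKuriharaWitnessAtTwoExp W k 0 0 Dk v₃ D κ Λ₀ κ' ∧
        KimAtThreeKolyvaginDefs.KatoKuriharaWitnessAtTwoExp W k' 0 0 Dk' v₃ D κu Λu κu' ∧
        ∀ e, Dk'.IsLevel e → Dk.IsLevel e →
          galoisCohomology.map red 1 (κu e) = κ e ∧ galoisCohomology.map red 1 (κu' e) = κ' e := by
  haveI : ContinuousSMul ℤ_[3] (W.tateModule 3) := TateModule.continuousSMul_padicInt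
  haveI : Module.Free ℤ_[3] (W.tateModule 3) := W.module_free_tateModule_holds 3
  haveI : Module.Finite ℤ_[3] (W.tateModule 3) := W.module_finite_tateModule_holds 3
  intro k k' Dk Dk' red hDk hDk' hk hred
  obtain ⟨κ, Λ₀, κ', κu, Λu, κu', hW, hW', hcomp⟩ :=
    portUnlocked_zero_of_fineKato₁_of_nonanomalous W D hN hsurj hv₃ ht ht₃ h3a hC1 η k k' Dk Dk' red hDk
      hDk' hk hred
  exact ⟨κ, Λ₀, κ', κu, Λu, κu', KimAtThreeKolyvaginDefs.katoKuriharaWitnessAtTwoExp_zero_of_witnessAt hW,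
    KimAtThreeKolyvaginDefs.katoKuriharaWitnessAtTwoExp_zero_of_witnessAt hW', hcomp⟩

/-- **SHALLOW = DEEP — the conclusion of cruxes 19599 `ShallowEqDeepOffKatoStratum` / 19077
`ShallowEqDeepAtTorsionFree` — AT a NON-ADDITIVE non-anomalous `t = 0` TOWER ROW with the datum at the
conductor, FROM PUB + (C1′) ALONE**: `∂^{(∞)}_deep(δ̃) ≤ ∂^{(∞)}(δ̃)` for `D.f`, from [S24] Thm 4.4 (1)(2),
GZK, Poitou–Tate (by name), the `3`-adic tower, `#E(ℚ₃)[3] = 1`, `3`-integral plus symbols, `ord(δ̃) = 0`, a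
place `v₃ ∣ 3`, one generator family `η`, the non-anomaly certificate and (C1′) for `D.f`.  Gen 7's
`KimAtThreeShallowEqDeepPortRows.shallowEqDeep_row_of_portUnlocked` on §2.  No `Addv`, no `3 ∤ c₃`, no `9 ∣ N`,
no Manin constant, no period transfer, no `hbad`, no auxiliary datum displayed.  Nothing booked.
[cite: Kim2025RefinedTNC, Thm 1.2] [cite: Kim2022StructureSelmer, Thm. 1.9 (6), Lemma 3.3, Thm. 3.13]
[cite: Sakamoto2024, Thm. 4.4 (p. 926)] [cite: MazurRubin2004, Thm. 5.2.12] [cite: Kato2004Asterisque, Thm. 9.7 (p. 189)] -/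
theorem shallowEqDeep_row_of_fineKato₁_of_nonanomalous
    (hS24 : Sakamoto2024.kolyvaginSystems_freeRankOne_zmod_three_pow)
    (hS24₂ : Sakamoto2024.kolyvaginSystems_idealOfBasis_eq_fittingIdeal_zmod_three_pow)
    (hGZK : rank_eq_analyticRank_of_analyticRank_le_one) (hPT : poitouTate_selmerStructure_duality ℚ)
    (htower : ∀ m : ℕ, W.HasSurjectiveModNGaloisRep (3 ^ m : ℕ))
    (ht : Nat.card {Q : (W.baseChange ℚ_[3]).toAffine.Point // (3 : ℕ) • Q = 0} = 1)
    {N : ℕ} [NeZero N] (D : ModularParametrizationData W N) (hN : N = W.conductorNorm ℤ)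
    (hint : ∀ r : ℚ, ratPlusSymbol D.f r ≠ 0 → 0 ≤ padicValRat 3 (ratPlusSymbol D.f r))
    (hord : kuriharaVanishingOrder W 3 D.f = 0)
    (v₃ : HeightOneSpectrum (𝓞 ℚ)) (hv₃ : ((3 : ℕ) : 𝓞 ℚ) ∈ v₃.asIdeal)
    (η : (q : HeightOneSpectrum (𝓞 ℚ)) → (ZMod (Ideal.absNorm q.asIdeal))ˣ)
    (hη : ∀ q : HeightOneSpectrum (𝓞 ℚ), Subgroup.zpowers (η q) = ⊤)
    {t₃ : ℤ} (ht₃ : cuspCoeff D.f 3 = t₃) (h3a : ¬ (3 : ℤ) ∣ 3 + (if 3 ∣ N then 0 else 1) - t₃)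
    (hC1 : ∀ [ContinuousSMul ℤ_[3] (W.tateModule 3)] [Module.Free ℤ_[3] (W.tateModule 3)]
      [Module.Finite ℤ_[3] (W.tateModule 3)],
      ∃ (ι : (n : ℕ) → (CyclotomicField n ℚ →+* ℂ)) (κK : ℝ)
        (Λ : ∀ (k' : ℕ) (r : Finset (HeightOneSpectrum (𝓞 ℚ))),
          H1 (tateRep W 3) (cycSubgroup 3 k' r) →ₗ[ℤ_[3]]
            ℚ_[3] ⊗[ℚ] CyclotomicField (cycLevel 3 k' r) ℚ)
        (Λfin : ∀ j : ℕ, galoisCohomology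
          ((W.torsionGaloisModule (((3 : ℕ) : ℤ) ^ j * ((3 : ℕ) : ℤ))).toLocal (Sum.inr v₃)) 1 →+
            ZMod (3 ^ (j + 1))),
        κK ≠ 0 ∧ (∃ u : ℚ, (u : ℝ) = κK ∧ padicValRat 3 u = 0) ∧
        (∀ j : ℕ, KatoExpStarFiniteLevelAt W 3 j 1 v₃ Λ (Λfin j)) ∧
        ∀ (c d a : ℤ) (A : ℕ), 0 < A → Int.gcd c (6 * 3 * A) = 1 → Int.gcd d (6 * 3 * N) = 1 →
          ∃ (z : ∀ (k' : ℕ) (r : (cyclotomicLevelsRat 3 (badPlaces c d A N)).Ideals),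
                H1 (tateRep W 3) ((cyclotomicLevelsRat 3 (badPlaces c d A N)).level k' r.1))
            (x : ∀ (k' : ℕ) (r : (cyclotomicLevelsRat 3 (badPlaces c d A N)).Ideals),
                CyclotomicField (cycLevel 3 k' r.1) ℚ),
            ZetaBody W 3 D.f ι κK Λ c d a A z x) :
    kuriharaPartialDeepInfty W 3 D.f ≤ kuriharaPartialInfty W 3 D.f :=
  KimAtThreeShallowEqDeepPortRows.shallowEqDeep_row_of_portUnlocked hS24 hS24₂ hGZK hPT W htower D 0 hint hord
    v₃ hv₃ η hη
    (portTwoExp_zero_of_fineKato₁_of_nonanomalous W D hN (by simpa using htower 1) hv₃ ht ht₃ h3a hC1 η) hN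

/-- **The LEAF row (`N11.KimAtThreeRankZeroPUB` at the row = Kim's clause (6) at `p = 3`): `∃ d, ∂^{(∞)} = d ∧
∂⁽⁰⁾ = ord₃ #Ш(3) + d` AT a NON-ADDITIVE non-anomalous `t = 0` TOWER ROW with the datum at the conductor, FROM
PUB + (C1′) ALONE** — same displayed inputs as `shallowEqDeep_row_of_fineKato₁_of_nonanomalous`; gen 7's
`KimAtThreeShallowEqDeepPortRows.leaf_row_of_portUnlocked` on §2.  Nothing booked; BSD is not proved by this.
[cite: Kim2025RefinedTNC, Thm 1.1] [cite: Kim2022StructureSelmer, Thm. 1.9 (6)]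
[cite: Sakamoto2024, Thm. 4.4 (p. 926)] [cite: MazurRubin2004, Thm. 4.4.1 and Thm. 5.2.12] -/
theorem leaf_row_of_fineKato₁_of_nonanomalous
    (hS24 : Sakamoto2024.kolyvaginSystems_freeRankOne_zmod_three_pow)
    (hS24₂ : Sakamoto2024.kolyvaginSystems_idealOfBasis_eq_fittingIdeal_zmod_three_pow)
    (hGZK : rank_eq_analyticRank_of_analyticRank_le_one) (hPT : poitouTate_selmerStructure_duality ℚ)
    (htower : ∀ m : ℕ, W.HasSurjectiveModNGaloisRep (3 ^ m : ℕ))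
    (ht : Nat.card {Q : (W.baseChange ℚ_[3]).toAffine.Point // (3 : ℕ) • Q = 0} = 1)
    {N : ℕ} [NeZero N] (D : ModularParametrizationData W N) (hN : N = W.conductorNorm ℤ)
    (hint : ∀ r : ℚ, ratPlusSymbol D.f r ≠ 0 → 0 ≤ padicValRat 3 (ratPlusSymbol D.f r))
    (hord : kuriharaVanishingOrder W 3 D.f = 0)
    (v₃ : HeightOneSpectrum (𝓞 ℚ)) (hv₃ : ((3 : ℕ) : 𝓞 ℚ) ∈ v₃.asIdeal)
    (η : (q : HeightOneSpectrum (𝓞 ℚ)) → (ZMod (Ideal.absNorm q.asIdeal))ˣ)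
    (hη : ∀ q : HeightOneSpectrum (𝓞 ℚ), Subgroup.zpowers (η q) = ⊤)
    {t₃ : ℤ} (ht₃ : cuspCoeff D.f 3 = t₃) (h3a : ¬ (3 : ℤ) ∣ 3 + (if 3 ∣ N then 0 else 1) - t₃)
    (hC1 : ∀ [ContinuousSMul ℤ_[3] (W.tateModule 3)] [Module.Free ℤ_[3] (W.tateModule 3)]
      [Module.Finite ℤ_[3] (W.tateModule 3)],
      ∃ (ι : (n : ℕ) → (CyclotomicField n ℚ →+* ℂ)) (κK : ℝ)
        (Λ : ∀ (k' : ℕ) (r : Finset (HeightOneSpectrum (𝓞 ℚ))),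
          H1 (tateRep W 3) (cycSubgroup 3 k' r) →ₗ[ℤ_[3]]
            ℚ_[3] ⊗[ℚ] CyclotomicField (cycLevel 3 k' r) ℚ)
        (Λfin : ∀ j : ℕ, galoisCohomology
          ((W.torsionGaloisModule (((3 : ℕ) : ℤ) ^ j * ((3 : ℕ) : ℤ))).toLocal (Sum.inr v₃)) 1 →+
            ZMod (3 ^ (j + 1))),
        κK ≠ 0 ∧ (∃ u : ℚ, (u : ℝ) = κK ∧ padicValRat 3 u = 0) ∧
        (∀ j : ℕ, KatoExpStarFiniteLevelAt W 3 j 1 v₃ Λ (Λfin j)) ∧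
        ∀ (c d a : ℤ) (A : ℕ), 0 < A → Int.gcd c (6 * 3 * A) = 1 → Int.gcd d (6 * 3 * N) = 1 →
          ∃ (z : ∀ (k' : ℕ) (r : (cyclotomicLevelsRat 3 (badPlaces c d A N)).Ideals),
                H1 (tateRep W 3) ((cyclotomicLevelsRat 3 (badPlaces c d A N)).level k' r.1))
            (x : ∀ (k' : ℕ) (r : (cyclotomicLevelsRat 3 (badPlaces c d A N)).Ideals),
                CyclotomicField (cycLevel 3 k' r.1) ℚ),
            ZetaBody W 3 D.f ι κK Λ c d a A z x) :
    ∃ dd : ℕ, kuriharaPartialInfty W 3 D.f = dd ∧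
      kuriharaPartial W 3 D.f 0 =
        ((padicValNat 3 (Nat.card (AddCommGroup.primaryComponent W.sha 3)) + dd : ℕ) : ℕ∞) :=
  KimAtThreeShallowEqDeepPortRows.leaf_row_of_portUnlocked hS24 hS24₂ hGZK hPT W htower D 0 hint hord
    v₃ hv₃ η hη
    (portTwoExp_zero_of_fineKato₁_of_nonanomalous W D hN (by simpa using htower 1) hv₃ ht ht₃ h3a hC1 η) hN

/-- **The LOWER row — the conclusion of cruxes 19679 `DeepLowerAtThreeOffKatoStratum` / 19075 `DeepLowerAtThree`:
`∃ d, ∂^{(∞)}_deep = d ∧ ∂⁽⁰⁾ ≤ ord₃ #Ш(3) + d` — AT a NON-ADDITIVE non-anomalous `t = 0` TOWER ROW with the datum at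
the conductor, FROM PUB + (C1′) ALONE** (for the 19679 owner: no named IMC fact, no Vatsal congruence, no K1 leaf on
these rows) — same displayed inputs as `shallowEqDeep_row_of_fineKato₁_of_nonanomalous`; gen 7's
`KimAtThreeShallowEqDeepPortRows.lower_row_of_portUnlocked` on §2.  Nothing booked; BSD is not proved by this.
[cite: Kim2022StructureSelmer, Thm. 1.9 (6), §1.5.1] [cite: MazurRubin2004, Def. 5.2.11, Thm. 5.2.12 (i)]
[cite: Sakamoto2024, Thm. 4.4 (p. 926)] -/
theorem lower_row_of_fineKato₁_of_nonanomalous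
    (hS24 : Sakamoto2024.kolyvaginSystems_freeRankOne_zmod_three_pow)
    (hS24₂ : Sakamoto2024.kolyvaginSystems_idealOfBasis_eq_fittingIdeal_zmod_three_pow)
    (hGZK : rank_eq_analyticRank_of_analyticRank_le_one) (hPT : poitouTate_selmerStructure_duality ℚ)
    (htower : ∀ m : ℕ, W.HasSurjectiveModNGaloisRep (3 ^ m : ℕ))
    (ht : Nat.card {Q : (W.baseChange ℚ_[3]).toAffine.Point // (3 : ℕ) • Q = 0} = 1)
    {N : ℕ} [NeZero N] (D : ModularParametrizationData W N) (hN : N = W.conductorNorm ℤ)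
    (hint : ∀ r : ℚ, ratPlusSymbol D.f r ≠ 0 → 0 ≤ padicValRat 3 (ratPlusSymbol D.f r))
    (hord : kuriharaVanishingOrder W 3 D.f = 0)
    (v₃ : HeightOneSpectrum (𝓞 ℚ)) (hv₃ : ((3 : ℕ) : 𝓞 ℚ) ∈ v₃.asIdeal)
    (η : (q : HeightOneSpectrum (𝓞 ℚ)) → (ZMod (Ideal.absNorm q.asIdeal))ˣ)
    (hη : ∀ q : HeightOneSpectrum (𝓞 ℚ), Subgroup.zpowers (η q) = ⊤)
    {t₃ : ℤ} (ht₃ : cuspCoeff D.f 3 = t₃) (h3a : ¬ (3 : ℤ) ∣ 3 + (if 3 ∣ N then 0 else 1) - t₃)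
    (hC1 : ∀ [ContinuousSMul ℤ_[3] (W.tateModule 3)] [Module.Free ℤ_[3] (W.tateModule 3)]
      [Module.Finite ℤ_[3] (W.tateModule 3)],
      ∃ (ι : (n : ℕ) → (CyclotomicField n ℚ →+* ℂ)) (κK : ℝ)
        (Λ : ∀ (k' : ℕ) (r : Finset (HeightOneSpectrum (𝓞 ℚ))),
          H1 (tateRep W 3) (cycSubgroup 3 k' r) →ₗ[ℤ_[3]]
            ℚ_[3] ⊗[ℚ] CyclotomicField (cycLevel 3 k' r) ℚ)
        (Λfin : ∀ j : ℕ, galoisCohomology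
          ((W.torsionGaloisModule (((3 : ℕ) : ℤ) ^ j * ((3 : ℕ) : ℤ))).toLocal (Sum.inr v₃)) 1 →+
            ZMod (3 ^ (j + 1))),
        κK ≠ 0 ∧ (∃ u : ℚ, (u : ℝ) = κK ∧ padicValRat 3 u = 0) ∧
        (∀ j : ℕ, KatoExpStarFiniteLevelAt W 3 j 1 v₃ Λ (Λfin j)) ∧
        ∀ (c d a : ℤ) (A : ℕ), 0 < A → Int.gcd c (6 * 3 * A) = 1 → Int.gcd d (6 * 3 * N) = 1 →
          ∃ (z : ∀ (k' : ℕ) (r : (cyclotomicLevelsRat 3 (badPlaces c d A N)).Ideals),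
                H1 (tateRep W 3) ((cyclotomicLevelsRat 3 (badPlaces c d A N)).level k' r.1))
            (x : ∀ (k' : ℕ) (r : (cyclotomicLevelsRat 3 (badPlaces c d A N)).Ideals),
                CyclotomicField (cycLevel 3 k' r.1) ℚ),
            ZetaBody W 3 D.f ι κK Λ c d a A z x) :
    ∃ dd : ℕ, kuriharaPartialDeepInfty W 3 D.f = dd ∧
      kuriharaPartial W 3 D.f 0 ≤
        ((padicValNat 3 (Nat.card (AddCommGroup.primaryComponent W.sha 3)) + dd : ℕ) : ℕ∞) :=
  KimAtThreeShallowEqDeepPortRows.lower_row_of_portUnlocked hS24 hS24₂ hGZK hPT W htower D 0 hint hord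
    v₃ hv₃ η hη
    (portTwoExp_zero_of_fineKato₁_of_nonanomalous W D hN (by simpa using htower 1) hv₃ ht ht₃ h3a hC1 η) hN

end Rows

end Summit.BirchSwinnertonDyer.BirchSwinnertonDyer.Theorems.KimAtThreeShallowEqDeepPortNonAddFineKato

end
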